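import Literature.InformationTheory.NetworkCoding.OneShot

/-!
# Route CodingVolumeShifts — crux `CodingVolume` (stmt-PneNP-19454): information flow in a binary
# one-shot code, and the rung `C = 2`

Structural lemmas about `KPairsNet.Code` (one bit per arc, locality at the tail, decodability at
the sinks) that every volume argument for the crux X = `CodingVolume` consumes, and the first rung
of the ladder.

* `codingVolume_val_eq_of_downClosed` — an arc's bit depends only on the source bits UPSTREAM of
  its tail: if a set of vertices is closed under predecessors, two inputs agreeing on the sources
  in it give the same bits on every arc leaving it (rank induction on `local_`).
* `codingVolume_exists_dep_inArc_sink` — sink `i` has an in-arc whose bit DEPENDS on `x_i`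
  (else `decode` fails on `x` and `x` with bit `i` flipped).
* `codingVolume_dep_upstream` — an `x_i`-dependent arc either leaves `source i` or has an
  `x_i`-dependent arc entering its tail; `codingVolume_indep_of_src_source` — arcs leaving
  `source j ≠ i` do not depend on `x_i`.
* `codingVolume_exists_outArc_source` — every source has an out-arc;
  `codingVolume_exists_inArc_sink_nonsource` — if `source i`, `sink i` are at undirected distance
  `≥ 2`, sink `i` has an in-arc from a NON-source vertex.
* `codingVolume_two_mul_card_le_arcCount` — RUNG `C = 2`: a `2`-far coded network has
  `2k ≤ m` (out-arcs of sources and non-source in-arcs of sinks are `2k` distinct arcs; no degree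
  bound needed), and `codingVolume_rung_two`, the `C = 2` slice of `CodingVolume` (`L = 2`, every
  `Δ`).

"Depends on `x_i`" is spelled out as the negation of
`∀ x x', (∀ j, j ≠ i → x j = x' j) → c.val a x = c.val a x'`; no definitions are introduced.
Route-independent: imports only the Literature vocabulary (`KPairsNet`, `KPairsNet.Code`), not the
Theses file, so that files building on these lemmas stay outside the route's rebuild cone.
-/

set_option linter.dupNamespace false -- `Summit.PneNP.PneNP.…`: summit = sub-problem name (D-0017)

namespace Summit.PneNP.PneNP.Theorems

open Literature.InformationTheory.NetworkCoding Finset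

variable {ι : Type} {N : KPairsNet ι}

/-- UPSTREAM DEPENDENCE. If `P` is a set of vertices closed under predecessors along arcs
(`P (tgt b) → P (src b)`) and two inputs agree on every source in `P`, then every arc whose tail
is in `P` carries the same bit on both inputs. (Rank induction on the locality axiom of a one-shot
code.) [folklore] -/
theorem codingVolume_val_eq_of_downClosed (c : N.Code) (P : N.V → Prop)
    (hP : ∀ b, P (N.tgt b) → P (N.src b)) {x x' : ι → Bool}
    (hx : ∀ i, P (N.source i) → x i = x' i) : ∀ a, P (N.src a) → c.val a x = c.val a x' := by
  suffices h : ∀ r : ℕ, ∀ a, N.rank (N.src a) = r → P (N.src a) → c.val a x = c.val a x' from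
    fun a => h _ a rfl
  intro r
  induction r using Nat.strong_induction_on with
  | _ r ih =>
    intro a hr hPa
    refine c.local_ a x x' (fun b hb => ?_) (fun i hi => hx i (by rw [hi]; exact hPa))
    have hPb : P (N.src b) := hP b (by rw [hb]; exact hPa)
    exact ih (N.rank (N.src b)) (by rw [← hr, ← hb]; exact N.rank_lt b) b rfl hPb

/-- DECODING NEEDS INFORMATION. Sink `i` has an in-arc whose bit depends on `x_i`, i.e. is not
invariant under changing `x_i` alone. [folklore] -/
theorem codingVolume_exists_dep_inArc_sink (c : N.Code) (i : ι) :
    ∃ b, N.tgt b = N.sink i ∧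
      ¬ ∀ x x' : ι → Bool, (∀ j, j ≠ i → x j = x' j) → c.val b x = c.val b x' := by
  classical
  by_contra h
  push Not at h
  have key := c.decode i (fun _ => true) (Function.update (fun _ => true) i false)
    (fun b hb => h b hb _ _ (fun j hj => by rw [Function.update_of_ne hj]))
  simp at key

/-- Arcs leaving ANOTHER source `j ≠ i` carry only `x_j`, hence do not depend on `x_i`.
[folklore] -/
theorem codingVolume_indep_of_src_source (c : N.Code) {i j : ι} (hji : j ≠ i) (a : N.A)
    (ha : N.src a = N.source j) :
    ∀ x x' : ι → Bool, (∀ j, j ≠ i → x j = x' j) → c.val a x = c.val a x' := by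
  intro x x' hx
  refine c.local_ a x x' (fun b hb => absurd (hb.trans ha) (N.source_in b j)) (fun j' hj' => ?_)
  have : j' = j := N.source.injective (hj'.trans ha)
  subst this
  exact hx j' hji

/-- INFORMATION COMES FROM UPSTREAM. An arc whose bit depends on `x_i` either leaves `source i`
or has an `x_i`-dependent arc entering its tail. [folklore] -/
theorem codingVolume_dep_upstream (c : N.Code) (i : ι) (a : N.A)
    (ha : ¬ ∀ x x' : ι → Bool, (∀ j, j ≠ i → x j = x' j) → c.val a x = c.val a x') :
    N.src a = N.source i ∨
      ∃ b, N.tgt b = N.src a ∧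
        ¬ ∀ x x' : ι → Bool, (∀ j, j ≠ i → x j = x' j) → c.val b x = c.val b x' := by
  by_contra h
  push Not at h
  obtain ⟨hsrc, hin⟩ := h
  apply ha
  intro x x' hx
  refine c.local_ a x x' (fun b hb => hin b hb x x' hx) (fun j hj => hx j ?_)
  rintro rfl
  exact hsrc hj.symm

/-- Every source has at least one out-arc (else no arc depends on its bit and its sink cannot
decode). [folklore] -/
theorem codingVolume_exists_outArc_source (c : N.Code) (i : ι) : ∃ a, N.src a = N.source i := by
  by_contra h
  push Not at h
  obtain ⟨b, -, hdep⟩ := codingVolume_exists_dep_inArc_sink c i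
  apply hdep
  intro x x' hx
  exact codingVolume_val_eq_of_downClosed c (fun v => v ≠ N.source i) (fun b' _ => h b')
    (fun j hj => hx j (fun hji => hj (by rw [hji]))) b (h b)

/-- If `source i` and `sink i` are at undirected distance `≥ 2`, then sink `i` has an in-arc from a
vertex that is NOT a source (an `x_i`-dependent in-arc cannot come from another source, and not
from `source i` itself, which is not adjacent to `sink i`). [folklore] -/
theorem codingVolume_exists_inArc_sink_nonsource (c : N.Code) (i : ι)
    (hfar : (2 : ℕ∞) ≤ N.graph.edist (N.source i) (N.sink i)) :
    ∃ b, N.tgt b = N.sink i ∧ ∀ j, N.src b ≠ N.source j := by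
  obtain ⟨b, hb, hdep⟩ := codingVolume_exists_dep_inArc_sink c i
  refine ⟨b, hb, fun j hj => ?_⟩
  by_cases hji : j = i
  · subst hji
    -- the arc `b : source j → sink j` makes the pair adjacent
    have hne : N.source j ≠ N.sink j := by
      intro h
      rw [h, SimpleGraph.edist_self] at hfar
      exact absurd hfar (by decide)
    have hadj : N.graph.Adj (N.source j) (N.sink j) := by
      rw [KPairsNet.graph, SimpleGraph.fromRel_adj]
      exact ⟨hne, Or.inl ⟨b, hj, hb⟩⟩
    have h1 : N.graph.edist (N.source j) (N.sink j) = 1 :=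
      SimpleGraph.edist_eq_one_iff_adj.mpr hadj
    rw [h1] at hfar
    exact absurd hfar (by decide)
  · exact hdep (codingVolume_indep_of_src_source c hji b hj)

/-- **Rung `C = 2` of `CodingVolume` (arc form).** A k-pairs network whose pairs are all at
undirected distance `≥ 2` and which carries a binary one-shot code has at least `2k` arcs: the
`k` sources have `k` distinct out-arcs, the `k` sinks have `k` distinct in-arcs from non-sources,
and these two arc sets are disjoint. No degree bound is used. [folklore] -/
theorem codingVolume_two_mul_card_le_arcCount [Fintype ι] (N : KPairsNet ι) (hfar : N.Far 2)
    (c : N.Code) : 2 * Fintype.card ι ≤ N.arcCount := by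
  classical
  set S1 : Finset N.A := univ.filter fun a => ∃ i, N.src a = N.source i with hS1
  set S2 : Finset N.A :=
    univ.filter fun a => (∃ i, N.tgt a = N.sink i) ∧ ∀ j, N.src a ≠ N.source j with hS2
  have hdisj : Disjoint S1 S2 := by
    rw [hS1, hS2, Finset.disjoint_filter]
    rintro a - ⟨i, hi⟩ ⟨-, hns⟩
    exact hns i hi
  choose f hf using fun i => codingVolume_exists_outArc_source c i
  choose g hg hgs using fun i => codingVolume_exists_inArc_sink_nonsource c i (hfar i)
  have h1 : Fintype.card ι ≤ S1.card := by
    rw [← Finset.card_univ]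
    refine Finset.card_le_card_of_injOn f (fun i _ => ?_) (fun i _ i' _ h => ?_)
    · rw [Finset.mem_coe, hS1, Finset.mem_filter]
      exact ⟨Finset.mem_univ _, i, hf i⟩
    · exact N.source.injective ((hf i).symm.trans ((congrArg N.src h).trans (hf i')))
  have h2 : Fintype.card ι ≤ S2.card := by
    rw [← Finset.card_univ]
    refine Finset.card_le_card_of_injOn g (fun i _ => ?_) (fun i _ i' _ h => ?_)
    · rw [Finset.mem_coe, hS2, Finset.mem_filter]
      exact ⟨Finset.mem_univ _, ⟨i, hg i⟩, hgs i⟩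
    · exact N.sink.injective ((hg i).symm.trans ((congrArg N.tgt h).trans (hg i')))
  calc 2 * Fintype.card ι ≤ S1.card + S2.card := by omega
    _ = (S1.disjUnion S2 hdisj).card := (Finset.card_disjUnion _ _ _).symm
    _ ≤ Fintype.card N.A := Finset.card_le_univ _
    _ = N.arcCount := rfl

/-- **Rung `C = 2` of `CodingVolume` (crux stmt-PneNP-19454), in the shape of the crux:** for
every degree bound `Δ` the distance `L = 2` already forces `2k ≤ m`. This is the `C = 2` slice of
`Summit.PneNP.PneNP.Theses.CodingVolumeShifts.CodingVolume` (`∀ Δ C, ∃ L, …` at `C = 2`).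
[folklore] -/
theorem codingVolume_rung_two : ∀ Δ : ℕ, ∃ L : ℕ, ∀ (ι : Type) [Fintype ι] (N : KPairsNet ι),
    N.DegLE Δ → N.Far L → Nonempty N.Code → 2 * Fintype.card ι ≤ N.arcCount :=
  fun _ => ⟨2, fun _ _ N _ hfar hc => hc.elim fun c => codingVolume_two_mul_card_le_arcCount N hfar c⟩

end Summit.PneNP.PneNP.Theorems
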